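import Summits.Ventures.Crystal3D.Theorems.StickyWulffConstantCoaxialWallLawGrainLedgerTop
import Summits.Ventures.Crystal3D.Theorems.StickyWulffConstantGenericWallFloorSampleDeficitUpper
import Summits.Ventures.Crystal3D.Theorems.StickyWulffConstantGenericWallFloorRigidRung
import Literature.MathematicalPhysics.StatisticalMechanics.WulffCrystalGammaLimit
import HarnessLib

/-!
# The two-grain terrace/riser ledger of a RIGID co-axial wall cell (pair-agnostic form)

HONEST FRAMING. Part of the venture `Summits/Ventures/Crystal3D` (cell `crystal3d-full`), helper
`--supports` the crux `CoaxialWallLaw` (stmt-Ventures-19481, `route-Ventures-StickyWulffConstant`),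
REGISTERED line `WallLedgerF` (planner cf-p1 gen 16), stub `stub_coaxialTwoSlabAdhesion`
(terrace/riser slot ledger, RIGID rung).  Rung credit only.

Adds the two grain lemmas (`coaxial_grain_ledger_ge`, `coaxial_grain_ledger_ge_top`) over the
partition `X = (X ∩ Λ₁) ⊔ (X ∩ Λ₂)` of a RIGID filling (`X ⊆ Λ₁ ∪ Λ₂`, grains disjoint):

**Theorem (`coaxial_rigid_cell_ledger`).**  In the clamped cylinder cell of the stub (both slabs
complete, `3 ≤ R₀ ≤ ρ`), for grains `Λᵢ = Mᵢ·Λ₀ + tᵢ` presented by ANY isometries `Mᵢ`, if every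
ball of each grain satisfies the crude absorption inequality about its own basal plane
(`#{w : w₂ = 0, x + Mᵢ w ∉ X} + 4·deg x ≤ 48` — an HYPOTHESIS here, landed for twin pairs,
translation pairs under the axis rule, and non-co-axial pairs), then

  `2·D(X) ≥ (2φ₁ + (√6/4)·√(1 − ⟪M₁e₃, e₃⟫²)) πρ² + (2φ₂ + (√6/4)·√(1 − ⟪M₂e₃, e₃⟫²)) πρ² − 2 C(R₀)(1+h)ρ`,

`φᵢ = (√2/4) Σ_{w ∈ fccSlots} |⟪Mᵢ w, e₃⟫|`: the two OUTER faces plus `(√6/4)·sin θ` per grain.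
Also the bookkeeping identity `sum_abs_inner_slots_eq_of_movedFcc_eq` (the face flux
`Σ |⟪A w, e₃⟫|` depends only on the point set `A·Λ₀ + t`); `2·D(X) = Σ_x (12 − deg x)` and the
crux's `φ(A⁻¹e₃)` as a slot sum are line `WallLedgerG`'s `two_mul_contactDeficiency_eq_sum`,
`finsum_unit_fcc_symm_eq_sum_slots` (`…GenericWallFloorRigidRung`).

WHAT THIS IS NOT: the frame normalisation and the discharge of the absorption hypothesis (next
file, twin pairs), the stub; rung F-C1 not moved.
-/

noncomputable section

namespace Summit.Ventures.Crystal3D.Theorems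

open Summit.Ventures.Crystal3D Finset
open Literature.MathematicalPhysics.StatisticalMechanics (fccStacking contactDeficiency
  orderedContacts sum_card_filter_dist_eq_orderedContacts)
open scoped InnerProductSpace

/-- **The face flux depends only on the point set.**  If `A·Λ₀ + t = B·Λ₀ + s` as sets then
`Σ_{w ∈ fccSlots} |⟪A w, e₃⟫| = Σ_{w ∈ fccSlots} |⟪B w, e₃⟫|` (the slot vectors of the two
presentations are the same twelve vectors). -/
theorem sum_abs_inner_slots_eq_of_movedFcc_eq
    (A B : EuclideanSpace ℝ (Fin 3) ≃ₗᵢ[ℝ] EuclideanSpace ℝ (Fin 3)) (t s : EuclideanSpace ℝ (Fin 3))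
    (h : (fun q => A q + t) '' fccStacking 1 (Real.sqrt (2 / 3)) =
      (fun q => B q + s) '' fccStacking 1 (Real.sqrt (2 / 3))) :
    ∑ w ∈ fccSlots, |⟪A w, EuclideanSpace.single (2 : Fin 3) (1 : ℝ)⟫_ℝ| =
      ∑ w ∈ fccSlots, |⟪B w, EuclideanSpace.single (2 : Fin 3) (1 : ℝ)⟫_ℝ| := by
  classical
  -- `w ↦ B⁻¹ (A w)` maps the slots into the slots
  have hmap : ∀ w ∈ fccSlots, B.symm (A w) ∈ fccSlots := by
    intro w hw
    have hwΛ := mem_fcc_of_mem_fccSlots hw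
    have hp : A w + t ∈ (fun q => B q + s) '' fccStacking 1 (Real.sqrt (2 / 3)) := by
      rw [← h]; exact ⟨w, hwΛ, rfl⟩
    have hq : A (w + w) + t ∈ (fun q => B q + s) '' fccStacking 1 (Real.sqrt (2 / 3)) := by
      rw [← h]; exact ⟨w + w, add_mem_fcc_of_mem_fccSlots hwΛ hw, rfl⟩
    have hd : dist (A w + t) (A (w + w) + t) = 1 := by
      rw [dist_eq_norm, map_add, show A w + t - (A w + A w + t) = -A w by abel, norm_neg,
        LinearIsometryEquiv.norm_map, norm_eq_one_of_mem_fccSlots hw]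
    have key := symm_sub_mem_fccSlots B s (A w + t) (A (w + w) + t) hp hq hd
    have e : A (w + w) + t - (A w + t) = A w := by rw [map_add]; abel
    rwa [e] at key
  have hinj : Set.InjOn (fun w => B.symm (A w)) ↑fccSlots := by
    intro w _ w' _ hww'
    exact A.injective (B.symm.injective hww')
  have himg : fccSlots.image (fun w => B.symm (A w)) = fccSlots := by
    apply Finset.eq_of_subset_of_card_le
    · intro v hv
      obtain ⟨w, hw, rfl⟩ := mem_image.1 hv
      exact hmap w hw
    · rw [card_image_of_injOn hinj]
  calc ∑ w ∈ fccSlots, |⟪A w, EuclideanSpace.single (2 : Fin 3) (1 : ℝ)⟫_ℝ|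
      = ∑ w ∈ fccSlots, |⟪B (B.symm (A w)), EuclideanSpace.single (2 : Fin 3) (1 : ℝ)⟫_ℝ| := by
        simp only [LinearIsometryEquiv.apply_symm_apply]
    _ = ∑ v ∈ fccSlots.image (fun w => B.symm (A w)), |⟪B v, EuclideanSpace.single (2 : Fin 3) (1 : ℝ)⟫_ℝ| := by
        rw [sum_image hinj]
    _ = _ := by rw [himg]

open scoped Classical in
/-- **The two-grain ledger of a rigid co-axial wall cell.**  See the module docstring. -/
theorem coaxial_rigid_cell_ledger
    (M₁ : EuclideanSpace ℝ (Fin 3) ≃ₗᵢ[ℝ] EuclideanSpace ℝ (Fin 3)) (t₁ : EuclideanSpace ℝ (Fin 3))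
    (M₂ : EuclideanSpace ℝ (Fin 3) ≃ₗᵢ[ℝ] EuclideanSpace ℝ (Fin 3)) (t₂ : EuclideanSpace ℝ (Fin 3))
    (X P₁ P₂ : Finset (EuclideanSpace ℝ (Fin 3))) (R₀ h ρ : ℝ) (hR₀ : 3 ≤ R₀) (hh : 0 ≤ h) (hρ : R₀ ≤ ρ)
    (hX : ∀ p ∈ X, ∀ q ∈ X, p ≠ q → 1 ≤ dist p q)
    (hcell : ∀ p ∈ X, -(2 * R₀) ≤ p 2 ∧ p 2 ≤ h + 2 * R₀ ∧ p 0 ^ 2 + p 1 ^ 2 ≤ ρ ^ 2)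
    (hP₁X : P₁ ⊆ X) (hP₂X : P₂ ⊆ X)
    (hP₁ : ∀ p, p ∈ P₁ ↔ (p ∈ (fun q => M₁ q + t₁) '' fccStacking 1 (Real.sqrt (2 / 3)) ∧
      -(2 * R₀) ≤ p 2 ∧ p 2 ≤ -R₀ ∧ p 0 ^ 2 + p 1 ^ 2 ≤ ρ ^ 2))
    (hP₂ : ∀ p, p ∈ P₂ ↔ (p ∈ (fun q => M₂ q + t₂) '' fccStacking 1 (Real.sqrt (2 / 3)) ∧
      h + R₀ ≤ p 2 ∧ p 2 ≤ h + 2 * R₀ ∧ p 0 ^ 2 + p 1 ^ 2 ≤ ρ ^ 2))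
    (hdisj : ∀ p ∈ (fun q => M₁ q + t₁) '' fccStacking 1 (Real.sqrt (2 / 3)),
      p ∉ (fun q => M₂ q + t₂) '' fccStacking 1 (Real.sqrt (2 / 3)))
    (hrigid : ∀ p ∈ X, p ∈ (fun q => M₁ q + t₁) '' fccStacking 1 (Real.sqrt (2 / 3)) ∨
      p ∈ (fun q => M₂ q + t₂) '' fccStacking 1 (Real.sqrt (2 / 3)))
    (habs₁ : ∀ x ∈ X, x ∈ (fun q => M₁ q + t₁) '' fccStacking 1 (Real.sqrt (2 / 3)) →
      (fccSlots.filter fun w => w 2 = 0 ∧ x + M₁ w ∉ X).card +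
        4 * (X.filter fun q => dist x q = 1).card ≤ 48)
    (habs₂ : ∀ x ∈ X, x ∈ (fun q => M₂ q + t₂) '' fccStacking 1 (Real.sqrt (2 / 3)) →
      (fccSlots.filter fun w => w 2 = 0 ∧ x + M₂ w ∉ X).card +
        4 * (X.filter fun q => dist x q = 1).card ≤ 48) :
    (2 * (Real.sqrt 2 / 4 * ∑ w ∈ fccSlots, |⟪M₁ w, EuclideanSpace.single (2 : Fin 3) (1 : ℝ)⟫_ℝ|) +
        Real.sqrt 6 / 4 * Real.sqrt (1 - ⟪M₁ (EuclideanSpace.single (2 : Fin 3) (1 : ℝ)),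
          EuclideanSpace.single (2 : Fin 3) (1 : ℝ)⟫_ℝ ^ 2)) * Real.pi * ρ ^ 2 +
      (2 * (Real.sqrt 2 / 4 * ∑ w ∈ fccSlots, |⟪M₂ w, EuclideanSpace.single (2 : Fin 3) (1 : ℝ)⟫_ℝ|) +
        Real.sqrt 6 / 4 * Real.sqrt (1 - ⟪M₂ (EuclideanSpace.single (2 : Fin 3) (1 : ℝ)),
          EuclideanSpace.single (2 : Fin 3) (1 : ℝ)⟫_ℝ ^ 2)) * Real.pi * ρ ^ 2 -
      2 * ((120 * Real.sqrt 2 * Real.pi + 3 / 4 * Real.sqrt 2 * Real.pi * (6 * R₀ + 16) +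
          720 * (4 * R₀ + 2)) * (1 + h) * ρ) ≤
      2 * contactDeficiency X := by
  classical
  set Λ₁ : Set (EuclideanSpace ℝ (Fin 3)) := (fun q => M₁ q + t₁) '' fccStacking 1 (Real.sqrt (2 / 3)) with hΛ₁
  set Λ₂ : Set (EuclideanSpace ℝ (Fin 3)) := (fun q => M₂ q + t₂) '' fccStacking 1 (Real.sqrt (2 / 3)) with hΛ₂
  -- slab completeness in the `∀ p ∈ Λ, window → p ∈ X` form
  have hc₁ : ∀ p ∈ Λ₁, -(2 * R₀) ≤ p 2 → p 2 ≤ -R₀ → p 0 ^ 2 + p 1 ^ 2 ≤ ρ ^ 2 → p ∈ X :=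
    fun p hp h1 h2 h3 => hP₁X ((hP₁ p).2 ⟨hp, h1, h2, h3⟩)
  have hc₂ : ∀ p ∈ Λ₂, h + R₀ ≤ p 2 → p 2 ≤ h + 2 * R₀ → p 0 ^ 2 + p 1 ^ 2 ≤ ρ ^ 2 → p ∈ X :=
    fun p hp h1 h2 h3 => hP₂X ((hP₂ p).2 ⟨hp, h1, h2, h3⟩)
  have hdisj' : ∀ p ∈ Λ₂, p ∉ Λ₁ := fun p hp2 hp1 => hdisj p hp1 hp2
  -- the two grain lemmas
  have g₁ := coaxial_grain_ledger_ge M₁ t₁ M₂ t₂ X P₁ R₀ h ρ hR₀ hh hρ hX hcell hP₁X hP₁ hc₂ hdisj habs₁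
  have g₂ := coaxial_grain_ledger_ge_top M₂ t₂ M₁ t₁ X P₂ R₀ h ρ hR₀ hh hρ hX hcell hP₂X hP₂ hc₁ hdisj'
    habs₂
  -- the two grains partition `X`
  have hunion : (X.filter fun p => p ∈ Λ₁) ∪ (X.filter fun p => p ∈ Λ₂) = X := by
    ext p
    simp only [mem_union, mem_filter]
    constructor
    · rintro (⟨hp, -⟩ | ⟨hp, -⟩) <;> exact hp
    · intro hp
      rcases hrigid p hp with h1 | h2
      · exact Or.inl ⟨hp, h1⟩
      · exact Or.inr ⟨hp, h2⟩
  have hdj : Disjoint (X.filter fun p => p ∈ Λ₁) (X.filter fun p => p ∈ Λ₂) := by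
    rw [disjoint_filter]
    exact fun p _ h1 h2 => hdisj p h1 h2
  have hsplit : ∑ x ∈ X, ((12 : ℝ) - ((X.filter fun q => dist x q = 1).card : ℝ)) =
      ∑ x ∈ X.filter (fun p => p ∈ Λ₁), ((12 : ℝ) - ((X.filter fun q => dist x q = 1).card : ℝ)) +
        ∑ x ∈ X.filter (fun p => p ∈ Λ₂), ((12 : ℝ) - ((X.filter fun q => dist x q = 1).card : ℝ)) := by
    rw [← sum_union hdj, hunion]
  rw [two_mul_contactDeficiency_eq_sum, hsplit]
  linarith

end Summit.Ventures.Crystal3D.Theorems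

end
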